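import Mathlib
import HarnessLib
import Literature.Geometry.DiscreteGeometry.BondGraph
import Literature.Geometry.DiscreteGeometry.KissingPatterns
import Summits.AtomisticToContinuum.Crystallization.Theorems.PricedLinkCensusSoftLayerPropagationStubMetricOcta
import Summits.AtomisticToContinuum.Crystallization.Theorems.PricedLinkCensusSoftLayerPropagationStubMetricBipyramid

/-!
# Small-cluster rigidity V: the octahedron and bipyramid lemmas at a general length scale, distance form
# (crux `SoftLayerPropagation`, line `Sketch`, stub `stub_metric`, registered sub-goal `metric_octahedron_dist`)

Route `PricedLinkCensus`, crux `SoftLayerPropagation` (stmt-AtomisticToContinuum-14233), line `Sketch`.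
The unit-scale lemmas `metric_octahedron`, `metric_bipyramid` rescaled to an arbitrary edge scale
`ℓ > 0` and restated with the LENGTH window `ℓ ≤ dist ≤ (1 + ε) ℓ` of the bond setting
(`ε ≤ 1/25`; the squared window is then `[ℓ², (1+α) ℓ²]` with `α = 2ε + ε² ≤ 1/10`):

* **`metric_octahedron_dist`** (registered): diagonal pairs `(a,c)`, `(b,d)`, `(x,z)`, the twelve edges
  in `[ℓ, (1+ε)ℓ]`, the three diagonals `≥ ℓ` ⇒ common centre `‖(a+c) − (b+d)‖ ≤ (13/4)(2ε+ε²) ℓ` (and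
  cyclically; so the far apex is `z = a + c − x` up to `(13/4)(2ε+ε²) ℓ`), squared diagonals in
  `[(2 − 2α − 21α²/2) ℓ², (2 + 4α + 6α²) ℓ²]`;
* `metric_bipyramid_dist`: face `a b c`, apices `d e`, nine edges in `[ℓ, (1+ε)ℓ]`, `dist d e ≥ ℓ` ⇒
  `‖3(d+e) − 2(a+b+c)‖ ≤ (31/2)(2ε+ε²) ℓ` and `dist d e ² ∈ [(8/3 − 4α/3 − 27α²) ℓ², (8/3 + 4α) ℓ²]`.

Proof: apply the unit lemmas to the points `ℓ⁻¹ • p`.  All `[folklore]`.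
-/

noncomputable section

namespace Summit.AtomisticToContinuum.Crystallization.Theorems

open Literature.Geometry.DiscreteGeometry

/-- Rescaling a squared distance: `‖ℓ⁻¹ • p − ℓ⁻¹ • q‖² = (dist p q)² / ℓ²`. [folklore] -/
theorem norm_inv_smul_sub_sq {ℓ : ℝ} (hℓ : 0 < ℓ) (p q : EuclideanSpace ℝ (Fin 3)) :
    ‖ℓ⁻¹ • p - ℓ⁻¹ • q‖ ^ 2 = dist p q ^ 2 / ℓ ^ 2 := by
  rw [← smul_sub, norm_smul, Real.norm_eq_abs, abs_of_pos (inv_pos.2 hℓ), dist_eq_norm, mul_pow, inv_pow]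
  ring

/-- The length window `ℓ ≤ dist ≤ (1+ε) ℓ` gives the unit squared window `1 ≤ ‖·‖² ≤ 1 + (2ε + ε²)` after
rescaling by `ℓ⁻¹`. [folklore] -/
theorem window_rescale {ℓ ε : ℝ} (hℓ : 0 < ℓ) {p q : EuclideanSpace ℝ (Fin 3)}
    (h₁ : ℓ ≤ dist p q) (h₂ : dist p q ≤ (1 + ε) * ℓ) :
    1 ≤ ‖ℓ⁻¹ • p - ℓ⁻¹ • q‖ ^ 2 ∧ ‖ℓ⁻¹ • p - ℓ⁻¹ • q‖ ^ 2 ≤ 1 + (2 * ε + ε ^ 2) := by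
  rw [norm_inv_smul_sub_sq hℓ]
  have hℓ2 : 0 < ℓ ^ 2 := by positivity
  constructor
  · rw [le_div_iff₀ hℓ2, one_mul]
    exact pow_le_pow_left₀ hℓ.le h₁ 2
  · rw [div_le_iff₀ hℓ2]
    have h0 : 0 ≤ dist p q := dist_nonneg
    calc dist p q ^ 2 ≤ ((1 + ε) * ℓ) ^ 2 := pow_le_pow_left₀ h0 h₂ 2
      _ = (1 + (2 * ε + ε ^ 2)) * ℓ ^ 2 := by ring

/-- The one-sided version: `ℓ ≤ dist p q` gives `1 ≤ ‖ℓ⁻¹•p − ℓ⁻¹•q‖²`. [folklore] -/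
theorem floor_rescale {ℓ : ℝ} (hℓ : 0 < ℓ) {p q : EuclideanSpace ℝ (Fin 3)} (h₁ : ℓ ≤ dist p q) :
    1 ≤ ‖ℓ⁻¹ • p - ℓ⁻¹ • q‖ ^ 2 := by
  rw [norm_inv_smul_sub_sq hℓ, le_div_iff₀ (by positivity : (0 : ℝ) < ℓ ^ 2), one_mul]
  exact pow_le_pow_left₀ hℓ.le h₁ 2

/-- Undoing the rescaling on a conclusion `‖ℓ⁻¹ • v‖² ≤ C`: `‖v‖² ≤ C ℓ²`. [folklore] -/
theorem norm_sq_le_of_rescaled {ℓ C : ℝ} (hℓ : 0 < ℓ) {v : EuclideanSpace ℝ (Fin 3)}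
    (h : ‖ℓ⁻¹ • v‖ ^ 2 ≤ C) : ‖v‖ ^ 2 ≤ C * ℓ ^ 2 := by
  rw [norm_smul, Real.norm_eq_abs, abs_of_pos (inv_pos.2 hℓ), mul_pow, inv_pow,
    ← div_eq_inv_mul, div_le_iff₀ (by positivity)] at h
  exact h

/-- Undoing the rescaling on a two-sided conclusion about `‖ℓ⁻¹ • p − ℓ⁻¹ • q‖²`. [folklore] -/
theorem dist_sq_bounds_of_rescaled {ℓ A B : ℝ} (hℓ : 0 < ℓ) {p q : EuclideanSpace ℝ (Fin 3)}
    (h : A ≤ ‖ℓ⁻¹ • p - ℓ⁻¹ • q‖ ^ 2 ∧ ‖ℓ⁻¹ • p - ℓ⁻¹ • q‖ ^ 2 ≤ B) :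
    A * ℓ ^ 2 ≤ dist p q ^ 2 ∧ dist p q ^ 2 ≤ B * ℓ ^ 2 := by
  rw [norm_inv_smul_sub_sq hℓ] at h
  have hℓ2 : (0 : ℝ) < ℓ ^ 2 := by positivity
  exact ⟨(le_div_iff₀ hℓ2).1 h.1, (div_le_iff₀ hℓ2).1 h.2⟩

/-- `‖v‖² ≤ K² α² ℓ²` with `K, α, ℓ ≥ 0` gives `‖v‖ ≤ K α ℓ`. [folklore] -/
theorem norm_le_of_sq_le {K α ℓ : ℝ} (hK : 0 ≤ K) (hα : 0 ≤ α) (hℓ : 0 ≤ ℓ) {v : EuclideanSpace ℝ (Fin 3)}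
    (h : ‖v‖ ^ 2 ≤ (K * α * ℓ) ^ 2) : ‖v‖ ≤ K * α * ℓ :=
  (pow_le_pow_iff_left₀ (norm_nonneg _) (by positivity) two_ne_zero).1 h

set_option maxHeartbeats 800000 in
/-- **Registered sub-goal `metric_octahedron_dist`: the octahedron lemma at scale `ℓ`, distance form.**
Diagonal pairs `(a,c)`, `(b,d)`, `(x,z)`; twelve edges with `ℓ ≤ dist ≤ (1+ε) ℓ`, `0 ≤ ε ≤ 1/25`, the
three diagonals `≥ ℓ`.  With `α = 2ε + ε²`: the centres agree, `‖(a+c) − (b+d)‖ ≤ (13/4) α ℓ` (and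
cyclically), and the squared diagonals lie in `[(2 − 2α − 21α²/2) ℓ², (2 + 4α + 6α²) ℓ²]`. [folklore] -/
theorem metric_octahedron_dist : ∀ ε ℓ : ℝ, 0 ≤ ε → ε ≤ 1 / 25 → 0 < ℓ →
    ∀ (a c b d x z : EuclideanSpace ℝ (Fin 3)),
      ℓ ≤ dist a b → dist a b ≤ (1 + ε) * ℓ → ℓ ≤ dist a d → dist a d ≤ (1 + ε) * ℓ →
      ℓ ≤ dist c b → dist c b ≤ (1 + ε) * ℓ → ℓ ≤ dist c d → dist c d ≤ (1 + ε) * ℓ →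
      ℓ ≤ dist b x → dist b x ≤ (1 + ε) * ℓ → ℓ ≤ dist b z → dist b z ≤ (1 + ε) * ℓ →
      ℓ ≤ dist d x → dist d x ≤ (1 + ε) * ℓ → ℓ ≤ dist d z → dist d z ≤ (1 + ε) * ℓ →
      ℓ ≤ dist x a → dist x a ≤ (1 + ε) * ℓ → ℓ ≤ dist x c → dist x c ≤ (1 + ε) * ℓ →
      ℓ ≤ dist z a → dist z a ≤ (1 + ε) * ℓ → ℓ ≤ dist z c → dist z c ≤ (1 + ε) * ℓ →
      ℓ ≤ dist a c → ℓ ≤ dist b d → ℓ ≤ dist x z →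
      ‖a + c - (b + d)‖ ≤ 13 / 4 * (2 * ε + ε ^ 2) * ℓ ∧ ‖b + d - (x + z)‖ ≤ 13 / 4 * (2 * ε + ε ^ 2) * ℓ ∧
        ‖x + z - (a + c)‖ ≤ 13 / 4 * (2 * ε + ε ^ 2) * ℓ ∧
      ((2 - 2 * (2 * ε + ε ^ 2) - 21 / 2 * (2 * ε + ε ^ 2) ^ 2) * ℓ ^ 2 ≤ dist a c ^ 2 ∧
        dist a c ^ 2 ≤ (2 + 4 * (2 * ε + ε ^ 2) + 6 * (2 * ε + ε ^ 2) ^ 2) * ℓ ^ 2) ∧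
      ((2 - 2 * (2 * ε + ε ^ 2) - 21 / 2 * (2 * ε + ε ^ 2) ^ 2) * ℓ ^ 2 ≤ dist b d ^ 2 ∧
        dist b d ^ 2 ≤ (2 + 4 * (2 * ε + ε ^ 2) + 6 * (2 * ε + ε ^ 2) ^ 2) * ℓ ^ 2) ∧
      ((2 - 2 * (2 * ε + ε ^ 2) - 21 / 2 * (2 * ε + ε ^ 2) ^ 2) * ℓ ^ 2 ≤ dist x z ^ 2 ∧
        dist x z ^ 2 ≤ (2 + 4 * (2 * ε + ε ^ 2) + 6 * (2 * ε + ε ^ 2) ^ 2) * ℓ ^ 2) := by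
  intro ε ℓ hε hε' hℓ a c b d x z hab hab' had had' hcb hcb' hcd hcd' hbx hbx' hbz hbz' hdx hdx' hdz hdz'
    hxa hxa' hxc hxc' hza hza' hzc hzc' hac hbd hxz
  set α := 2 * ε + ε ^ 2 with hαdef
  have hα : 0 ≤ α := by positivity
  have hα' : α ≤ 1 / 10 := by rw [hαdef]; nlinarith
  have W := fun {p q : EuclideanSpace ℝ (Fin 3)} (h₁ : ℓ ≤ dist p q) (h₂ : dist p q ≤ (1 + ε) * ℓ) =>
    window_rescale hℓ h₁ h₂
  have F := fun {p q : EuclideanSpace ℝ (Fin 3)} (h₁ : ℓ ≤ dist p q) => floor_rescale hℓ h₁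
  obtain ⟨o1, o2, o3, dac, dbd, dxz, -⟩ := metric_octahedron α hα hα' (ℓ⁻¹ • a) (ℓ⁻¹ • c) (ℓ⁻¹ • b)
    (ℓ⁻¹ • d) (ℓ⁻¹ • x) (ℓ⁻¹ • z)
    (W hab hab').1 (W hab hab').2 (W had had').1 (W had had').2 (W hcb hcb').1 (W hcb hcb').2
    (W hcd hcd').1 (W hcd hcd').2 (W hbx hbx').1 (W hbx hbx').2 (W hbz hbz').1 (W hbz hbz').2
    (W hdx hdx').1 (W hdx hdx').2 (W hdz hdz').1 (W hdz hdz').2 (W hxa hxa').1 (W hxa hxa').2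
    (W hxc hxc').1 (W hxc hxc').2 (W hza hza').1 (W hza hza').2 (W hzc hzc').1 (W hzc hzc').2
    (F hac) (F hbd) (F hxz)
  -- undo the rescaling
  have e1 : ℓ⁻¹ • a + ℓ⁻¹ • c - (ℓ⁻¹ • b + ℓ⁻¹ • d) = ℓ⁻¹ • (a + c - (b + d)) := by
    simp only [smul_add, smul_sub]
  have e2 : ℓ⁻¹ • b + ℓ⁻¹ • d - (ℓ⁻¹ • x + ℓ⁻¹ • z) = ℓ⁻¹ • (b + d - (x + z)) := by
    simp only [smul_add, smul_sub]
  have e3 : ℓ⁻¹ • x + ℓ⁻¹ • z - (ℓ⁻¹ • a + ℓ⁻¹ • c) = ℓ⁻¹ • (x + z - (a + c)) := by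
    simp only [smul_add, smul_sub]
  rw [e1] at o1; rw [e2] at o2; rw [e3] at o3
  have k : (21 : ℝ) / 2 ≤ (13 / 4) ^ 2 := by norm_num
  have c1 := norm_sq_le_of_rescaled hℓ o1
  have c2 := norm_sq_le_of_rescaled hℓ o2
  have c3 := norm_sq_le_of_rescaled hℓ o3
  have hα2 : 0 ≤ α ^ 2 * ℓ ^ 2 := by positivity
  refine ⟨norm_le_of_sq_le (by norm_num) hα hℓ.le ?_, norm_le_of_sq_le (by norm_num) hα hℓ.le ?_,
    norm_le_of_sq_le (by norm_num) hα hℓ.le ?_, dist_sq_bounds_of_rescaled hℓ dac,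
    dist_sq_bounds_of_rescaled hℓ dbd, dist_sq_bounds_of_rescaled hℓ dxz⟩
  · nlinarith [c1, mul_le_mul_of_nonneg_right k hα2]
  · nlinarith [c2, mul_le_mul_of_nonneg_right k hα2]
  · nlinarith [c3, mul_le_mul_of_nonneg_right k hα2]

set_option maxHeartbeats 800000 in
/-- **The bipyramid lemma at scale `ℓ`, distance form.**  Face `a b c`, apices `d e`; nine edges with
`ℓ ≤ dist ≤ (1+ε) ℓ`, `0 ≤ ε ≤ 1/25`, `dist d e ≥ ℓ`.  With `α = 2ε + ε²`:
`‖3(d+e) − 2(a+b+c)‖ ≤ (31/2) α ℓ` (so `e = (2/3)(a+b+c) − d` up to `(31/6) α ℓ`) and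
`dist d e ² ∈ [(8/3 − 4α/3 − 27α²) ℓ², (8/3 + 4α) ℓ²]`. [folklore] -/
theorem metric_bipyramid_dist : ∀ ε ℓ : ℝ, 0 ≤ ε → ε ≤ 1 / 25 → 0 < ℓ →
    ∀ (a b c d e : EuclideanSpace ℝ (Fin 3)),
      ℓ ≤ dist a b → dist a b ≤ (1 + ε) * ℓ → ℓ ≤ dist a c → dist a c ≤ (1 + ε) * ℓ →
      ℓ ≤ dist b c → dist b c ≤ (1 + ε) * ℓ →
      ℓ ≤ dist d a → dist d a ≤ (1 + ε) * ℓ → ℓ ≤ dist d b → dist d b ≤ (1 + ε) * ℓ →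
      ℓ ≤ dist d c → dist d c ≤ (1 + ε) * ℓ →
      ℓ ≤ dist e a → dist e a ≤ (1 + ε) * ℓ → ℓ ≤ dist e b → dist e b ≤ (1 + ε) * ℓ →
      ℓ ≤ dist e c → dist e c ≤ (1 + ε) * ℓ →
      ℓ ≤ dist d e →
      ‖(3 : ℝ) • (d + e) - (2 : ℝ) • (a + b + c)‖ ≤ 31 / 2 * (2 * ε + ε ^ 2) * ℓ ∧
      (8 / 3 - 4 / 3 * (2 * ε + ε ^ 2) - 27 * (2 * ε + ε ^ 2) ^ 2) * ℓ ^ 2 ≤ dist d e ^ 2 ∧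
      dist d e ^ 2 ≤ (8 / 3 + 4 * (2 * ε + ε ^ 2)) * ℓ ^ 2 := by
  intro ε ℓ hε hε' hℓ a b c d e hab hab' hac hac' hbc hbc' hda hda' hdb hdb' hdc hdc' hea hea' heb heb'
    hec hec' hde
  set α := 2 * ε + ε ^ 2 with hαdef
  have hα : 0 ≤ α := by positivity
  have hα' : α ≤ 1 / 10 := by rw [hαdef]; nlinarith
  have W := fun {p q : EuclideanSpace ℝ (Fin 3)} (h₁ : ℓ ≤ dist p q) (h₂ : dist p q ≤ (1 + ε) * ℓ) =>
    window_rescale hℓ h₁ h₂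
  obtain ⟨hM, -, -, lo, hi⟩ := metric_bipyramid α hα hα' (ℓ⁻¹ • a) (ℓ⁻¹ • b) (ℓ⁻¹ • c) (ℓ⁻¹ • d) (ℓ⁻¹ • e)
    (W hab hab').1 (W hab hab').2 (W hac hac').1 (W hac hac').2 (W hbc hbc').1 (W hbc hbc').2
    (W hda hda').1 (W hda hda').2 (W hdb hdb').1 (W hdb hdb').2 (W hdc hdc').1 (W hdc hdc').2
    (W hea hea').1 (W hea hea').2 (W heb heb').1 (W heb heb').2 (W hec hec').1 (W hec hec').2
    (floor_rescale hℓ hde)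
  have e1 : (3 : ℝ) • (ℓ⁻¹ • d + ℓ⁻¹ • e) - (2 : ℝ) • (ℓ⁻¹ • a + ℓ⁻¹ • b + ℓ⁻¹ • c) =
      ℓ⁻¹ • ((3 : ℝ) • (d + e) - (2 : ℝ) • (a + b + c)) := by
    simp only [smul_add, smul_sub, smul_comm (3 : ℝ) ℓ⁻¹, smul_comm (2 : ℝ) ℓ⁻¹]
  rw [e1] at hM
  have c1 := norm_sq_le_of_rescaled hℓ hM
  have k : (240 : ℝ) ≤ (31 / 2) ^ 2 := by norm_num
  have hα2 : 0 ≤ α ^ 2 * ℓ ^ 2 := by positivity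
  obtain ⟨dlo, dhi⟩ := dist_sq_bounds_of_rescaled hℓ ⟨lo, hi⟩
  refine ⟨norm_le_of_sq_le (by norm_num) hα hℓ.le ?_, dlo, dhi⟩
  nlinarith [c1, mul_le_mul_of_nonneg_right k hα2]

end Summit.AtomisticToContinuum.Crystallization.Theorems

end
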